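import Summits.AnomalousDissipation.AnomalousDissipation.Theorems.SawtoothPulseCascadeK1LocalisedCascadePhaseOneHFibreEval

/-!
# K1loc, line `Spectral` / thin start — helper: THE TWO TAILS OF THE PHASE-ONE T-H JUNK («PhaseOneTails»)

Helper file of the prover lane on the crux `K1LocalisedCascade` (stmt-AnomalousDissipation-19491), route `SawtoothPulseCascade`
(glue seat; plan `PHASE1-DIRECT-SIZING-k1locp3g4.md` §4, D7 inputs).  The per-fibre bounds `X_n ≤ 5/4·v_n² + 5ρ_n²` of the generated
files `…PhaseOneHFibres*` leave two series to be bounded once: the `ℓ²` remainders `Σ_n ρ_n² ≤ R := Σ'_k [k₁ ∉ [1,Q_c]] ‖𝓕a₁(k)‖²`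
(the V-fibre energy of `a₁` off `1 ≤ |k₁| ≤ Q_c`) and the fibres beyond the explicit range, `τ := Σ'_k [|k₀| ≥ 401] ‖𝓕a₁(k)‖²`
(the H-energy tail of `a₁`; it dominates the same functional of `b₁` by H-invariance).  Both follow from the phase-one start inequality with
EXACT chirp weights `…PhaseOneStart.tsum_weight_sq_norm_phaseOne_le_exact` and two facts on the exact one-tooth chirp:
* `tsum_sq_norm_fourierCoeff_exactChirp` (Parseval, `= 1`), `sum_Ico_inv_pow_four_le` (`Σ_{N≤k} k⁻⁴ ≤ 1/(3(N−2)(N−1)N)`, telescoping) and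
  **`sum_tail_sq_norm_exactChirp_le`** / `tsum_tail_sq_norm_exactChirp_le`: `Σ_{|m|≥N} ‖ĝ₀(m)‖² ≤ T(λ,N) := 2(2|λ|·0.31831)²(N²/(N²−λ²))²/(3(N−2)(N−1)N)`;
* `tsum_tail_sq_norm_twist_le`: the ROUNDED chirp's tail, `≤ T + 2ε` (Parseval `= 1` and the inner window compared to the exact chirp);
* **`phaseOne_vRemainder_le`**: `R ≤ (√T(8,Q_c+1) + 2⁻²⁵)²` (`≈ 1.75·10⁻⁵` at `Q_c = 100`); `τ` is the companion file `…PhaseOneHTail`.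
No definitions; nothing about the crux. [cite: Grafakos2014, Prop. 3.1.2 (5), Prop. 3.2.7 (3)] [problem: turb]
-/

-- `Summit.<Summit>.<Problem>`: single-conjunct summit, the duplicate namespace segment is deliberate.
set_option linter.dupNamespace false

noncomputable section

namespace Summit.AnomalousDissipation.AnomalousDissipation.Theorems.SawtoothPulseCascade.K1Start

open MeasureTheory Filter Topology UnitAddTorus Complex AddCircle
open scoped Real
open Literature.Analysis Literature.Analysis.FunctionSpaces Literature.Analysis.FunctionSpaces.Torus Literature.Analysis.FluidPDE
open Literature.Analysis.FluidPDE.ShearStage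
open Literature.Analysis.FluidPDE.SawtoothCascade Literature.Analysis.FluidPDE.SawtoothCascade.CascadeParams
open Summit.AnomalousDissipation.AnomalousDissipation.Theorems.SawtoothPulseCascade.K1Window

/-! ## §1 The exact one-tooth chirp: Parseval and the spectral tail -/

/-- The exact chirp is unimodular. [folklore] -/
theorem norm_exactChirp_eq_one {lam : ℤ} {g₀ : UnitAddCircle → ℂ}
    (hg₀ : ∀ t : ℝ, g₀ (t : UnitAddCircle) = Complex.exp (-(2 * π * I * lam * ((tri (2 * π * t) / (2 * π) : ℝ) : ℂ))))
    (x : UnitAddCircle) : ‖g₀ x‖ = 1 := by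
  obtain ⟨t, rfl⟩ := QuotientAddGroup.mk_surjective x
  rw [show (QuotientAddGroup.mk t : UnitAddCircle) = ((t : ℝ) : UnitAddCircle) from rfl, hg₀ t,
    show (-(2 * π * I * lam * ((tri (2 * π * t) / (2 * π) : ℝ) : ℂ)) : ℂ) =
      ((-(2 * π * lam * (tri (2 * π * t) / (2 * π))) : ℝ) : ℂ) * I by push_cast; ring, Complex.norm_exp_ofReal_mul_I]

/-- **Parseval for the exact chirp**: `Σ'_m ‖ĝ₀(m)‖² = 1`. [cite: Grafakos2014, Prop. 3.2.7 (3)] -/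
theorem hasSum_sq_norm_fourierCoeff_exactChirp {lam : ℤ} {g₀ : UnitAddCircle → ℂ}
    (hg₀ : ∀ t : ℝ, g₀ (t : UnitAddCircle) = Complex.exp (-(2 * π * I * lam * ((tri (2 * π * t) / (2 * π) : ℝ) : ℂ))))
    (hg₀c : Continuous g₀) : HasSum (fun m : ℤ => ‖fourierCoeff g₀ m‖ ^ 2) 1 := by
  have hmem : MemLp g₀ 2 haarAddCircle :=
    (memLp_top_of_bound hg₀c.aestronglyMeasurable 1 (Eventually.of_forall fun b => (norm_exactChirp_eq_one hg₀ b).le)).mono_exponent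
      le_top
  have h := hasSum_sq_fourierCoeff (hmem.toLp _)
  have hcoe : ∀ p, fourierCoeff (hmem.toLp _) p = fourierCoeff g₀ p := by
    intro p
    simp only [fourierCoeff]
    exact integral_congr_ae (by filter_upwards [MemLp.coeFn_toLp hmem] with x hx; simp only [hx])
  have hint : ∫ t, ‖(hmem.toLp _) t‖ ^ 2 ∂haarAddCircle = 1 := by
    have h1 : ∫ t, ‖(hmem.toLp _) t‖ ^ 2 ∂haarAddCircle = ∫ t, ‖g₀ t‖ ^ 2 ∂haarAddCircle :=
      integral_congr_ae (by filter_upwards [MemLp.coeFn_toLp hmem] with t ht; rw [ht])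
    rw [h1]
    simp [norm_exactChirp_eq_one hg₀]
  simp_rw [hcoe] at h
  rwa [hint] at h

/-- **Telescoping `k⁻⁴`**: for `3 ≤ N ≤ M`, `Σ_{N ≤ k < M} 1/k⁴ ≤ 1/(3(N−2)(N−1)N)` (`k⁴ ≥ (k−2)(k−1)k(k+1)`). [folklore] -/
theorem sum_Ico_inv_pow_four_le {N : ℕ} (hN : 3 ≤ N) (M : ℕ) :
    ∑ k ∈ Finset.Ico N M, 1 / ((k : ℝ) ^ 4) ≤ 1 / (3 * ((N : ℝ) - 2) * ((N : ℝ) - 1) * N) := by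
  -- `Σ_{N ≤ k < M} 1/((k−2)(k−1)k(k+1)) = (1/3)(1/((N−2)(N−1)N) − 1/((M−2)(M−1)M))`
  have key : ∀ M, N ≤ M → ∑ k ∈ Finset.Ico N M, 1 / ((k : ℝ) ^ 4) ≤
      1 / 3 * (1 / (((N : ℝ) - 2) * ((N : ℝ) - 1) * N) - 1 / (((M : ℝ) - 2) * ((M : ℝ) - 1) * M)) := by
    intro M hM
    induction M, hM using Nat.le_induction with
    | base => simp
    | succ M hM ih =>
      rw [Finset.sum_Ico_succ_top hM]
      have hMr : (3 : ℝ) ≤ M := by exact_mod_cast hN.trans hM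
      have hA : (0 : ℝ) < (M : ℝ) - 2 := by linarith
      have hB : (0 : ℝ) < (M : ℝ) - 1 := by linarith
      have hC : (0 : ℝ) < (M : ℝ) := by linarith
      have hD : (0 : ℝ) < (M : ℝ) + 1 := by linarith
      have h1 : 1 / ((M : ℝ) ^ 4) ≤ 1 / (((M : ℝ) - 2) * ((M : ℝ) - 1) * M * (M + 1)) := by
        apply one_div_le_one_div_of_le (mul_pos (mul_pos (mul_pos hA hB) hC) hD)
        nlinarith [sq_nonneg ((M : ℝ) - 1), hMr]
      have e1 : (((M + 1 : ℕ) : ℝ) - 2) = (M : ℝ) - 1 := by push_cast; ring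
      have e2 : (((M + 1 : ℕ) : ℝ) - 1) = (M : ℝ) := by push_cast; ring
      have e3 : (((M + 1 : ℕ) : ℝ)) = (M : ℝ) + 1 := by push_cast; ring
      have h2 : 1 / (((M : ℝ) - 2) * ((M : ℝ) - 1) * M * (M + 1)) =
          1 / 3 * (1 / (((M : ℝ) - 2) * ((M : ℝ) - 1) * M) - 1 / ((((M + 1 : ℕ) : ℝ) - 2) * (((M + 1 : ℕ) : ℝ) - 1) * ((M + 1 : ℕ) : ℝ))) := by
        rw [e1, e2, e3]
        have hM2 : (M : ℝ) - 2 ≠ 0 := hA.ne'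
        have hM1 : (M : ℝ) - 1 ≠ 0 := hB.ne'
        have hM0 : (M : ℝ) ≠ 0 := hC.ne'
        have hM3 : (M : ℝ) + 1 ≠ 0 := hD.ne'
        field_simp
        ring
      linarith
  have hM0 : ∀ M : ℕ, N ≤ M → 0 ≤ 1 / (((M : ℝ) - 2) * ((M : ℝ) - 1) * M) := by
    intro M hM
    have hMr : (3 : ℝ) ≤ M := by exact_mod_cast hN.trans hM
    exact (one_div_pos.2 (mul_pos (mul_pos (by linarith) (by linarith)) (by linarith))).le
  rcases le_or_gt N M with hNM | hNM
  · have := key M hNM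
    have h0 := hM0 M hNM
    have e : 1 / (3 * ((N : ℝ) - 2) * ((N : ℝ) - 1) * N) = 1 / 3 * (1 / (((N : ℝ) - 2) * ((N : ℝ) - 1) * N)) := by
      rw [one_div_mul_one_div]; ring_nf
    linarith
  · rw [Finset.Ico_eq_empty (by omega), Finset.sum_empty]
    have hNr : (3 : ℝ) ≤ N := by exact_mod_cast hN
    exact (one_div_pos.2 (mul_pos (mul_pos (mul_pos (by norm_num : (0:ℝ) < 3) (by linarith)) (by linarith)) (by linarith))).le

/-- **THE SPECTRAL TAIL OF THE EXACT ONE-TOOTH CHIRP** (finite form): for `3 ≤ N`, `|λ| < N` and a finite set `S` of frequencies with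
`|m| ≥ N` on `S`: `Σ_{m∈S} ‖ĝ₀(m)‖² ≤ T(λ,N) = 2(2|λ|·0.31831)²(N²/(N²−λ²))²/(3(N−2)(N−1)N)`. [cite: Grafakos2014, Prop. 3.1.2 (5)] -/
theorem sum_tail_sq_norm_exactChirp_le {lam : ℤ} {g₀ : UnitAddCircle → ℂ}
    (hg₀ : ∀ t : ℝ, g₀ (t : UnitAddCircle) = Complex.exp (-(2 * π * I * lam * ((tri (2 * π * t) / (2 * π) : ℝ) : ℂ))))
    {N : ℕ} (hN : 3 ≤ N) (hlam : |lam| < (N : ℤ)) (S : Finset ℤ) (hS : ∀ m ∈ S, (N : ℤ) ≤ |m|) :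
    ∑ m ∈ S, ‖fourierCoeff g₀ m‖ ^ 2 ≤
      2 * (2 * |(lam : ℝ)| * 0.31831) ^ 2 * ((N : ℝ) ^ 2 / ((N : ℝ) ^ 2 - (lam : ℝ) ^ 2)) ^ 2 /
        (3 * ((N : ℝ) - 2) * ((N : ℝ) - 1) * N) := by
  classical
  have hπ : 0 < π := Real.pi_pos
  have hNr : (3 : ℝ) ≤ N := by exact_mod_cast hN
  have hlamr : |(lam : ℝ)| < N := by exact_mod_cast hlam
  have hκ : 0 < (N : ℝ) ^ 2 - (lam : ℝ) ^ 2 := by nlinarith [abs_nonneg (lam : ℝ), sq_abs (lam : ℝ)]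
  set C : ℝ := (2 * |(lam : ℝ)| * 0.31831) * ((N : ℝ) ^ 2 / ((N : ℝ) ^ 2 - (lam : ℝ) ^ 2)) with hC
  have hC0 : 0 ≤ C := by positivity
  -- termwise: `‖ĝ₀(m)‖ ≤ C / m²`
  have hterm : ∀ m ∈ S, ‖fourierCoeff g₀ m‖ ^ 2 ≤ C ^ 2 * (1 / ((m.natAbs : ℕ) : ℝ) ^ 4) := by
    intro m hm
    have hmN := hS m hm
    have hmr : (N : ℝ) ≤ |(m : ℝ)| := by exact_mod_cast hmN
    have hml : |(lam : ℝ)| < |(m : ℝ)| := lt_of_lt_of_le hlamr hmr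
    have hm₁ : lam + m ≠ 0 := by
      intro h; have : (m : ℝ) = -lam := by exact_mod_cast (by linarith : m = -lam)
      rw [this, abs_neg] at hml; exact lt_irrefl _ hml
    have hm₂ : lam - m ≠ 0 := by
      intro h; have : (m : ℝ) = lam := by exact_mod_cast (by linarith : m = lam)
      rw [this] at hml; exact lt_irrefl _ hml
    have h1 := norm_fourierCoeff_oneTooth_le_sharp lam hg₀ hm₁ hm₂
    have hm2 : (lam : ℝ) ^ 2 < (m : ℝ) ^ 2 := by nlinarith [sq_abs (lam : ℝ), sq_abs (m : ℝ), abs_nonneg (lam : ℝ)]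
    have hden : |(lam : ℝ) ^ 2 - (m : ℝ) ^ 2| = (m : ℝ) ^ 2 - (lam : ℝ) ^ 2 := by
      rw [abs_sub_comm]; exact abs_of_pos (by linarith)
    rw [hden] at h1
    -- `m² − λ² ≥ m²·(N²−λ²)/N²`
    have hm2' : (N : ℝ) ^ 2 ≤ (m : ℝ) ^ 2 := by nlinarith [sq_abs (m : ℝ), abs_nonneg (m : ℝ)]
    have hlow : (m : ℝ) ^ 2 * (((N : ℝ) ^ 2 - (lam : ℝ) ^ 2) / (N : ℝ) ^ 2) ≤ (m : ℝ) ^ 2 - (lam : ℝ) ^ 2 := by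
      rw [mul_div_assoc', div_le_iff₀ (by positivity)]
      nlinarith [sq_nonneg (lam : ℝ)]
    have hpos : 0 < (m : ℝ) ^ 2 * (((N : ℝ) ^ 2 - (lam : ℝ) ^ 2) / (N : ℝ) ^ 2) := by
      have : 0 < (m : ℝ) ^ 2 := by nlinarith
      positivity
    have h2 : 2 * |(lam : ℝ)| / (π * ((m : ℝ) ^ 2 - (lam : ℝ) ^ 2)) ≤ C / (m : ℝ) ^ 2 := by
      have hϖ := inv_pi_le_d5
      have e1 : 2 * |(lam : ℝ)| / (π * ((m : ℝ) ^ 2 - (lam : ℝ) ^ 2)) =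
          2 * |(lam : ℝ)| * (1 / π) * (1 / ((m : ℝ) ^ 2 - (lam : ℝ) ^ 2)) := by
        field_simp
      rw [e1]
      have e2 : C / (m : ℝ) ^ 2 = 2 * |(lam : ℝ)| * 0.31831 * (1 / ((m : ℝ) ^ 2 * (((N : ℝ) ^ 2 - (lam : ℝ) ^ 2) / (N : ℝ) ^ 2))) := by
        rw [hC]; field_simp
      rw [e2]
      have h3 : 1 / ((m : ℝ) ^ 2 - (lam : ℝ) ^ 2) ≤ 1 / ((m : ℝ) ^ 2 * (((N : ℝ) ^ 2 - (lam : ℝ) ^ 2) / (N : ℝ) ^ 2)) :=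
        one_div_le_one_div_of_le hpos hlow
      have h4 : 2 * |(lam : ℝ)| * (1 / π) ≤ 2 * |(lam : ℝ)| * 0.31831 := mul_le_mul_of_nonneg_left hϖ (by positivity)
      exact mul_le_mul h4 h3 (by positivity) (by positivity)
    have hmabs : ((m.natAbs : ℕ) : ℝ) ^ 4 = ((m : ℝ) ^ 2) ^ 2 := by
      rw [Nat.cast_natAbs, Int.cast_abs, show (4 : ℕ) = 2 * 2 by norm_num, pow_mul, sq_abs]
    rw [hmabs]
    calc ‖fourierCoeff g₀ m‖ ^ 2 ≤ (C / (m : ℝ) ^ 2) ^ 2 := pow_le_pow_left₀ (norm_nonneg _) (h1.trans h2) 2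
      _ = C ^ 2 * (1 / ((m : ℝ) ^ 2) ^ 2) := by rw [div_pow]; ring
  refine (Finset.sum_le_sum hterm).trans ?_
  rw [← Finset.mul_sum]
  -- fold `m ↦ |m|` : at most two preimages per value
  have hfold : ∑ m ∈ S, 1 / (((m.natAbs : ℕ) : ℝ)) ^ 4 ≤ 2 * ∑ k ∈ S.image Int.natAbs, 1 / ((k : ℝ)) ^ 4 := by
    rw [Finset.mul_sum, ← Finset.sum_fiberwise_of_maps_to (g := Int.natAbs) (fun m hm => Finset.mem_image_of_mem _ hm)]
    refine Finset.sum_le_sum fun k hk => ?_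
    have hcard : ((S.filter fun m => m.natAbs = k).card : ℝ) ≤ 2 := by
      have hsub : (S.filter fun m => m.natAbs = k) ⊆ ({(k : ℤ), -(k : ℤ)} : Finset ℤ) := by
        intro m hm
        rw [Finset.mem_filter] at hm
        rw [Finset.mem_insert, Finset.mem_singleton]
        omega
      have := Finset.card_le_card hsub
      have h2 : (({(k : ℤ), -(k : ℤ)} : Finset ℤ)).card ≤ 2 := Finset.card_le_two
      exact_mod_cast this.trans h2
    rw [Finset.sum_congr rfl fun m hm => by rw [(Finset.mem_filter.1 hm).2], Finset.sum_const, nsmul_eq_mul]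
    exact mul_le_mul_of_nonneg_right hcard (by positivity)
  -- the image lies in `[N, M)` for `M = 1 + max`
  set M : ℕ := (S.image Int.natAbs).sup id + 1 with hM
  have hsubI : S.image Int.natAbs ⊆ Finset.Ico N M := by
    intro k hk
    rw [Finset.mem_Ico]
    obtain ⟨m, hm, rfl⟩ := Finset.mem_image.1 hk
    constructor
    · have := hS m hm
      have : (N : ℤ) ≤ (m.natAbs : ℤ) := by rw [Int.natCast_natAbs]; exact this
      exact_mod_cast this
    · have : m.natAbs ≤ (S.image Int.natAbs).sup id := Finset.le_sup (f := id) hk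
      omega
  have hIco : ∑ k ∈ S.image Int.natAbs, 1 / ((k : ℝ)) ^ 4 ≤ ∑ k ∈ Finset.Ico N M, 1 / ((k : ℝ)) ^ 4 :=
    Finset.sum_le_sum_of_subset_of_nonneg hsubI fun k _ _ => by positivity
  have htel := sum_Ico_inv_pow_four_le hN M
  have hden0 : 0 < 3 * ((N : ℝ) - 2) * ((N : ℝ) - 1) * N := by
    exact mul_pos (mul_pos (mul_pos (by norm_num) (by linarith)) (by linarith)) (by linarith)
  calc C ^ 2 * ∑ m ∈ S, 1 / (((m.natAbs : ℕ) : ℝ)) ^ 4 ≤ C ^ 2 * (2 * (1 / (3 * ((N : ℝ) - 2) * ((N : ℝ) - 1) * N))) := by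
        refine mul_le_mul_of_nonneg_left (hfold.trans ?_) (sq_nonneg _)
        linarith [hIco.trans htel]
    _ = _ := by rw [hC]; field_simp

/-- **The spectral tail, series form**: `Σ'_m [|m| ≥ N] ‖ĝ₀(m)‖² ≤ T(λ,N)`. [cite: Grafakos2014, Prop. 3.1.2 (5), Prop. 3.2.7 (3)] -/
theorem tsum_tail_sq_norm_exactChirp_le {lam : ℤ} {g₀ : UnitAddCircle → ℂ}
    (hg₀ : ∀ t : ℝ, g₀ (t : UnitAddCircle) = Complex.exp (-(2 * π * I * lam * ((tri (2 * π * t) / (2 * π) : ℝ) : ℂ))))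
    {N : ℕ} (hN : 3 ≤ N) (hlam : |lam| < (N : ℤ)) :
    ∑' m : ℤ, (if (N : ℤ) ≤ |m| then ‖fourierCoeff g₀ m‖ ^ 2 else 0) ≤
      2 * (2 * |(lam : ℝ)| * 0.31831) ^ 2 * ((N : ℝ) ^ 2 / ((N : ℝ) ^ 2 - (lam : ℝ) ^ 2)) ^ 2 /
        (3 * ((N : ℝ) - 2) * ((N : ℝ) - 1) * N) := by
  classical
  refine Real.tsum_le_of_sum_le (fun m => by positivity) fun S => ?_
  rw [← Finset.sum_filter]
  exact sum_tail_sq_norm_exactChirp_le hg₀ hN hlam _ fun m hm => (Finset.mem_filter.1 hm).2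

/-! ## §2 The rounded chirp: tail mass from Parseval and the inner window -/

/-- **Tail mass of the rounded chirp**: if `‖twist ψ n x − g₀ x‖ ≤ ε` pointwise (`g₀` the exact chirp of lobe `λ`, `|λ| < N`, `3 ≤ N`) and
then `Σ'_m [|m| ≥ N] ‖ĝ_n(m)‖² ≤ T(λ,N) + 2ε` (Parseval `Σ'‖ĝ_n‖² = 1`; on the inner window `√Σ‖ĝ₀‖² ≤ √Σ‖ĝ_n‖² + ε`).
[cite: Grafakos2014, Prop. 3.2.7 (3)] -/
theorem tsum_tail_sq_norm_twist_le (ψ : ShearProfile) (n : ℤ) {lam : ℤ} {g₀ : UnitAddCircle → ℂ}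
    (hg₀ : ∀ t : ℝ, g₀ (t : UnitAddCircle) = Complex.exp (-(2 * π * I * lam * ((tri (2 * π * t) / (2 * π) : ℝ) : ℂ))))
    (hg₀c : Continuous g₀) {ε : ℝ} (hε : ∀ x, ‖twist ψ n x - g₀ x‖ ≤ ε) {N : ℕ} (hN : 3 ≤ N) (hlam : |lam| < (N : ℤ))
    {T : ℝ} (hT : 2 * (2 * |(lam : ℝ)| * 0.31831) ^ 2 * ((N : ℝ) ^ 2 / ((N : ℝ) ^ 2 - (lam : ℝ) ^ 2)) ^ 2 /
        (3 * ((N : ℝ) - 2) * ((N : ℝ) - 1) * N) ≤ T) :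
    ∑' m : ℤ, (if (N : ℤ) ≤ |m| then ‖fourierCoeff (twist ψ n) m‖ ^ 2 else 0) ≤ T + 2 * ε := by
  classical
  have hε0 : 0 ≤ ε := (norm_nonneg _).trans (hε 0)
  -- Parseval for both chirps
  have hP := hasSum_sq_norm_fourierCoeff_twist ψ n
  have hP₀ := hasSum_sq_norm_fourierCoeff_exactChirp hg₀ hg₀c
  set W : Finset ℤ := Finset.Ioo (-(N : ℤ)) N with hW
  -- inner + tail decomposition of the Parseval sums
  have hsplit : ∀ {f : ℤ → ℝ} {s : ℝ}, HasSum f s → (∀ m, 0 ≤ f m) →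
      ∑' m : ℤ, (if (N : ℤ) ≤ |m| then f m else 0) = s - ∑ m ∈ W, f m := by
    intro f s hf hf0
    have h1 : ∀ m, f m = (if (N : ℤ) ≤ |m| then f m else 0) + (if m ∈ W then f m else 0) := by
      intro m
      by_cases h : (N : ℤ) ≤ |m|
      · have : m ∉ W := by rw [hW, Finset.mem_Ioo, not_and_or]; rw [le_abs] at h; omega
        simp [h, this]
      · have : m ∈ W := by rw [hW, Finset.mem_Ioo]; rw [not_le, abs_lt] at h; exact h
        simp [h, this]
    have hs2 : Summable fun m => (if m ∈ W then f m else 0) := summable_of_ne_finset_zero (s := W) fun m hm => if_neg hm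
    have hs1 : Summable fun m => (if (N : ℤ) ≤ |m| then f m else 0) :=
      Summable.of_nonneg_of_le (fun m => by split_ifs <;> simp [hf0]) (fun m => by split_ifs <;> simp [hf0]) hf.summable
    have h2 := hs1.hasSum.add hs2.hasSum
    have h3 : HasSum f (∑' m, (if (N : ℤ) ≤ |m| then f m else 0) + ∑' m, (if m ∈ W then f m else 0)) :=
      h2.congr_fun fun m => (h1 m)
    have h4 : ∑' m, (if m ∈ W then f m else 0) = ∑ m ∈ W, f m := by
      rw [tsum_eq_sum (s := W) fun m hm => if_neg hm]; exact Finset.sum_congr rfl fun m hm => if_pos hm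
    have := hf.unique h3
    linarith
  rw [hsplit hP fun m => sq_nonneg _]
  have htail₀ : ∑' m : ℤ, (if (N : ℤ) ≤ |m| then ‖fourierCoeff g₀ m‖ ^ 2 else 0) = 1 - ∑ m ∈ W, ‖fourierCoeff g₀ m‖ ^ 2 :=
    hsplit hP₀ fun m => sq_nonneg _
  have hT₀ : 1 - ∑ m ∈ W, ‖fourierCoeff g₀ m‖ ^ 2 ≤ T := by
    rw [← htail₀]; exact (tsum_tail_sq_norm_exactChirp_le hg₀ hN hlam).trans hT
  -- inner window: `√A₀ ≤ √A + ε`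
  have hinner := sqrt_window_sq_le_of_near hg₀c (continuous_twist ψ n) (fun x => by rw [norm_sub_rev]; exact hε x)
    (fun _ => (1 : ℂ)) {0} W
  simp only [Finset.sum_singleton, one_mul, sub_zero, norm_one, one_pow, Real.sqrt_one, mul_one] at hinner
  set A := ∑ m ∈ W, ‖fourierCoeff (twist ψ n) m‖ ^ 2 with hA
  set A₀ := ∑ m ∈ W, ‖fourierCoeff g₀ m‖ ^ 2 with hA₀
  have hA0 : 0 ≤ A := Finset.sum_nonneg fun _ _ => sq_nonneg _
  have hA₀0 : 0 ≤ A₀ := Finset.sum_nonneg fun _ _ => sq_nonneg _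
  have hA₀1 : 1 - T ≤ A₀ := by linarith
  have hA₀le : A₀ ≤ 1 := sum_le_hasSum W (fun _ _ => sq_nonneg _) hP₀
  -- `1 − A ≤ T + 2ε`
  by_cases hcase : Real.sqrt A₀ ≤ ε
  · have h1 : A₀ ≤ ε * Real.sqrt A₀ := by
      calc A₀ = Real.sqrt A₀ * Real.sqrt A₀ := (Real.mul_self_sqrt hA₀0).symm
        _ ≤ ε * Real.sqrt A₀ := mul_le_mul_of_nonneg_right hcase (Real.sqrt_nonneg _)
    have h2 : Real.sqrt A₀ ≤ 1 := by simpa using Real.sqrt_le_sqrt hA₀le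
    have h3 : A₀ ≤ ε := h1.trans (by nlinarith [Real.sqrt_nonneg A₀])
    linarith
  · rw [not_le] at hcase
    have h1 : Real.sqrt A₀ - ε ≤ Real.sqrt A := by linarith
    have h2 : (Real.sqrt A₀ - ε) ^ 2 ≤ A := by
      calc (Real.sqrt A₀ - ε) ^ 2 ≤ Real.sqrt A ^ 2 := pow_le_pow_left₀ (by linarith) h1 2
        _ = A := Real.sq_sqrt hA0
    have h3 : (Real.sqrt A₀ - ε) ^ 2 = A₀ - 2 * ε * Real.sqrt A₀ + ε ^ 2 := by
      rw [sub_sq, Real.sq_sqrt hA₀0]; ring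
    have h4 : Real.sqrt A₀ ≤ 1 := by simpa using Real.sqrt_le_sqrt hA₀le
    nlinarith [sq_nonneg ε, Real.sqrt_nonneg A₀]

/-! ## §3 The `ℓ²` remainder of the per-fibre bounds: V-fibres of `a₁` off `1 ≤ |k₁| ≤ Q_c` -/

section Cascade

variable (P : CascadeParams)

/-- **THE `ℓ²` REMAINDER** (`Q_c ≥ 8`, `γ = 8`, `N₀ = 1`, `0 < δ₀ ≤ 2⁻³⁰`):
`Σ'_k [k₁ ∉ [1,Q_c] in absolute value] ‖𝓕a₁(k)‖² ≤ (√T(8,Q_c+1) + 2⁻²⁵)²` where the bracket is `0` if `1 ≤ |k₁| ≤ Q_c` and `1` otherwise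
(the V half-step is a translation on each V-fibre; `ĝ₀^{±}(0) = 0`; the exact chirp's tail beyond `Q_c`). [cite: Grafakos2014, Prop. 3.1.2 (5), Prop. 3.2.7 (3)] -/
theorem phaseOne_vRemainder_le (hγ : P.γ = 8) (hN₀ : P.N₀ = 1) (hδ₀ : 0 < P.δ₀) (hδ₀' : P.δ₀ ≤ (2 : ℝ)⁻¹ ^ 30) (hd : 0 < P.d)
    (a b : ℕ → UnitAddTorus (Fin 2) → ℝ) (h0 : a 0 = datum)
    (hb : b 0 = a 0 ∘ shearMap 0 1 (amp ⟨P.U 0, P.U_periodic 0, P.contDiff_U (P.δ_pos hδ₀ hd 0)⟩ P.γ))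
    (hab : a 1 = b 0 ∘ shearMap 1 0 (amp ⟨P.U 0, P.U_periodic 0, P.contDiff_U (P.δ_pos hδ₀ hd 0)⟩ P.γ))
    (Qc : ℕ) (hQc : 8 ≤ Qc) :
    ∑' k : Fin 2 → ℤ, (if 1 ≤ |k 1| ∧ |k 1| ≤ (Qc : ℤ) then (0 : ℝ) else 1) * ‖mFourierCoeff (fun x => (a 1 x : ℂ)) k‖ ^ 2 ≤
      (Real.sqrt (2 * (2 * |((8 : ℤ) : ℝ)| * 0.31831) ^ 2 * ((((Qc + 1 : ℕ) : ℝ)) ^ 2 / (((Qc + 1 : ℕ) : ℝ) ^ 2 - ((8 : ℤ) : ℝ) ^ 2)) ^ 2 /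
          (3 * (((Qc + 1 : ℕ) : ℝ) - 2) * (((Qc + 1 : ℕ) : ℝ) - 1) * ((Qc + 1 : ℕ) : ℝ))) + (2 : ℝ)⁻¹ ^ 25) ^ 2 := by
  classical
  have hπ : 0 < π := Real.pi_pos
  set ψ : ShearProfile := amp ⟨P.U 0, P.U_periodic 0, P.contDiff_U (P.δ_pos hδ₀ hd 0)⟩ P.γ with hψ
  set η : ℝ := 8 * ((2 * Real.exp (1 / 2) - 1) * P.δ₀ / (2 * π)) with hηdef
  have hη : ∀ t : ℝ, |ψ t - (8 : ℤ) * (tri (2 * π * t) / (2 * π))| ≤ η := by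
    intro t
    have h := phaseZero_profile_near P hγ hN₀ hδ₀ hd 1 t
    simpa [hψ, hηdef] using h
  have hηs : 2 * π * η ≤ (2 : ℝ)⁻¹ ^ 25 := by
    have e : 2 * π * η = 8 * (2 * Real.exp (1 / 2) - 1) * P.δ₀ := by rw [hηdef]; field_simp
    rw [e]; exact rounding_slope_le hδ₀.le hδ₀'
  have hη0 : 0 ≤ 2 * π * η := by
    have : 0 ≤ η := (abs_nonneg _).trans (hη 0); positivity
  rw [h0] at hb
  obtain ⟨gp, hgpc, hgp⟩ := exists_exactChirp 8
  obtain ⟨gm, hgmc, hgm⟩ := exists_exactChirp (-8)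
  -- the weight
  set W : (Fin 2 → ℤ) → ℝ := fun k => if 1 ≤ |k 1| ∧ |k 1| ≤ (Qc : ℤ) then 0 else 1 with hWdef
  have hW0 : ∀ k, 0 ≤ W k := fun k => by simp only [hWdef]; split_ifs <;> norm_num
  have hW1 : ∀ k, W k ≤ 1 := fun k => by simp only [hWdef]; split_ifs <;> norm_num
  have hgm' : ∀ t : ℝ, gm (t : UnitAddCircle) = Complex.exp (-(2 * π * I * (-(8 : ℤ)) * ((tri (2 * π * t) / (2 * π) : ℝ) : ℂ))) := by
    intro t; rw [hgm t]; push_cast; ring_nf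
  have hmain := tsum_weight_sq_norm_phaseOne_le_exact ψ hb hab hW0 hW1 8 hgp hgm' hgpc hgmc hη
  -- the fibre functionals: `Φ_n = [n ∉ S]`
  have hΦ : ∀ (c : ℤ) (n : ℤ), ∑' p : ℤ, W (![p, n]) * ‖fourierCoeff (twist ψ n) (p + c)‖ ^ 2 =
      (if 1 ≤ |n| ∧ |n| ≤ (Qc : ℤ) then 0 else 1) := by
    intro c n
    simp only [hWdef, Matrix.cons_val_one, Matrix.cons_val_zero]
    split_ifs with h
    · simp
    · simp only [one_mul]; exact tsum_sq_norm_fourierCoeff_twist_shift ψ n c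
  have hΦm : ∀ n : ℤ, ∑' p : ℤ, W (![p, n]) * ‖fourierCoeff (twist ψ n) (p + 1)‖ ^ 2 =
      (if 1 ≤ |n| ∧ |n| ≤ (Qc : ℤ) then 0 else 1) := hΦ 1
  have hΦp : ∀ n : ℤ, ∑' p : ℤ, W (![p, n]) * ‖fourierCoeff (twist ψ n) (p - 1)‖ ^ 2 =
      (if 1 ≤ |n| ∧ |n| ≤ (Qc : ℤ) then 0 else 1) := fun n => by simpa [sub_eq_add_neg] using hΦ (-1) n
  simp_rw [hΦm, hΦp] at hmain
  -- the exact chirps off `S`: zero mode vanishes, tail beyond `Qc`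
  set T : ℝ := 2 * (2 * |((8 : ℤ) : ℝ)| * 0.31831) ^ 2 * ((((Qc + 1 : ℕ) : ℝ)) ^ 2 / (((Qc + 1 : ℕ) : ℝ) ^ 2 - ((8 : ℤ) : ℝ) ^ 2)) ^ 2 /
    (3 * (((Qc + 1 : ℕ) : ℝ) - 2) * (((Qc + 1 : ℕ) : ℝ) - 1) * ((Qc + 1 : ℕ) : ℝ)) with hT
  have hN3 : 3 ≤ Qc + 1 := by omega
  have hoff : ∀ {g : UnitAddCircle → ℂ} (lam : ℤ), (lam = 8 ∨ lam = -8) →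
      (∀ t : ℝ, g (t : UnitAddCircle) = Complex.exp (-(2 * π * I * lam * ((tri (2 * π * t) / (2 * π) : ℝ) : ℂ)))) → Continuous g →
      ∑' n : ℤ, ‖fourierCoeff g n‖ ^ 2 * (if 1 ≤ |n| ∧ |n| ≤ (Qc : ℤ) then (0 : ℝ) else 1) ≤ T := by
    intro g lam hl hg hgc
    have hQ8 : (8 : ℤ) < ((Qc + 1 : ℕ) : ℤ) := by push_cast; omega
    have hlamQ : |lam| < ((Qc + 1 : ℕ) : ℤ) := by
      rcases hl with rfl | rfl
      · simpa using hQ8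
      · simpa [abs_neg] using hQ8
    have htail := tsum_tail_sq_norm_exactChirp_le hg hN3 hlamQ
    have h0 : fourierCoeff g 0 = 0 := by
      refine fourierCoeff_exactChirp_eq_zero_of_even hg hgc ?_ ?_ ?_
      · rcases hl with rfl | rfl <;> decide
      · rcases hl with rfl | rfl <;> decide
      · rcases hl with rfl | rfl <;> decide
    have hle : ∀ n : ℤ, ‖fourierCoeff g n‖ ^ 2 * (if 1 ≤ |n| ∧ |n| ≤ (Qc : ℤ) then (0 : ℝ) else 1) ≤
        (if (((Qc + 1 : ℕ)) : ℤ) ≤ |n| then ‖fourierCoeff g n‖ ^ 2 else 0) := by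
      intro n
      by_cases hn : 1 ≤ |n| ∧ |n| ≤ (Qc : ℤ)
      · rw [if_pos hn, mul_zero]; split_ifs <;> positivity
      · rw [if_neg hn, mul_one]
        rw [not_and_or, not_le, not_le] at hn
        rcases hn with hn | hn
        · have : n = 0 := Int.abs_lt_one_iff.1 hn
          rw [this, h0]; simp
        · rw [if_pos (by push_cast; omega)]
    have hs2 : Summable fun n : ℤ => (if (((Qc + 1 : ℕ)) : ℤ) ≤ |n| then ‖fourierCoeff g n‖ ^ 2 else 0) :=
      Summable.of_nonneg_of_le (fun n => by split_ifs <;> positivity) (fun n => by split_ifs <;> simp)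
        (hasSum_sq_norm_fourierCoeff_exactChirp hg hgc).summable
    have hs1 : Summable fun n : ℤ => ‖fourierCoeff g n‖ ^ 2 * (if 1 ≤ |n| ∧ |n| ≤ (Qc : ℤ) then (0 : ℝ) else 1) :=
      Summable.of_nonneg_of_le (fun n => by positivity) hle hs2
    have hlamr : ((lam : ℤ) : ℝ) ^ 2 = ((8 : ℤ) : ℝ) ^ 2 := by rcases hl with rfl | rfl <;> push_cast <;> norm_num
    have hlama : |((lam : ℤ) : ℝ)| = |((8 : ℤ) : ℝ)| := by rcases hl with rfl | rfl <;> push_cast <;> norm_num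
    rw [hlamr, hlama] at htail
    exact (Summable.tsum_le_tsum hle hs1 hs2).trans (htail.trans (le_of_eq (by rw [hT])))
  have hm := hoff (-8) (Or.inr rfl) hgm hgmc
  have hp := hoff 8 (Or.inl rfl) hgp hgpc
  have hT0 : 0 ≤ T := le_trans (tsum_nonneg fun n => by positivity) hp
  have hsq : ∀ {x : ℝ}, x ≤ T → 0 ≤ x → (Real.sqrt x + 2 * π * η) ^ 2 ≤ (Real.sqrt T + (2 : ℝ)⁻¹ ^ 25) ^ 2 := by
    intro x hx hx0
    exact pow_le_pow_left₀ (by positivity) (add_le_add (Real.sqrt_le_sqrt hx) hηs) 2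
  have h1 := hsq hm (tsum_nonneg fun n => by positivity)
  have h2 := hsq hp (tsum_nonneg fun n => by positivity)
  refine hmain.trans ?_
  rw [hT] at h1 h2 ⊢
  linarith

end Cascade

end Summit.AnomalousDissipation.AnomalousDissipation.Theorems.SawtoothPulseCascade.K1Start
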